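import Literature.AlgebraicGeometry.Deformation.MorphismLiftsSquareZeroAffine
import Mathlib.AlgebraicGeometry.Cover.Open
import Mathlib.AlgebraicGeometry.Gluing
import HarnessLib

/-!
# Gluing lifts across a square-zero thickening: the sheaf `𝒫(g₀)` and its global sections
# (SGA 1 III Prop. 5.1, global layer (iv): chartwise criterion for equality and gluing of local lifts)

Layer `Literature/AlgebraicGeometry/Deformation`, namespace `Literature.AlgebraicGeometry.Deformation`.
THEOREMS ONLY (no definition, no named fact, no instance).  Third file of the DEF-MOR chain (★
`MorphismLiftsSquareZeroAffine` = the affine torsor (ii), ★ `MorphismLiftsSquareZeroAffineFunctorial` = its naturality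
(v)).  [SGA1, Exp. III §5 Prop. 5.1] states that the extensions of `g₀` form a SHEAF `𝒫(g₀)` on `Y` which is formally
principal homogeneous under `𝒢 = 𝓗om(g₀^*Ω¹_{X/S}, 𝒥)`; the sheaf property — «les sections sur un ouvert `U` sont les
prolongements `g : U → X`» glue, and agree when they agree locally — is what turns the affine torsor into the global
one ([SGA1, Exp. III §5, p. 71]: «l'ensemble des prolongements globaux est un espace principal homogène sous
`H⁰(Y, 𝒢)`» as soon as it is non-empty; the obstruction to non-emptiness lives in `H¹(Y, 𝒢)`).  This file records that
sheaf layer at scheme level, def-free, over Mathlib's `Scheme.Cover.glueMorphisms` / `Scheme.Cover.hom_ext`: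

* §1 CHARTWISE EQUALITY: `eq_of_charts_eq` — two morphisms `Spec B → X` through an affine open `V` with equal charts are
  equal (★ §1 of the affine file); `eq_of_forall_exists_chart_eq` — two morphisms `P → X` from ANY scheme are equal as
  soon as every point of `P` has an affine test chart `t : Spec C → P` (an open immersion) on which they land in a
  common affine open of `X` with equal charts (the SHEAF CONDITION of `𝒫(g₀)`, uniqueness half); with ★ (ii) this reads:
  two `S`-lifts agreeing on the thickening are equal iff all their chart derivations vanish (`eq_of_derivations_eq_zero`);
* §2 GLUING: `exists_glue_of_lifts` — local `S`-lifts `g α : 𝒰.X α → X` on an open cover `𝒰` of `Z` which agree on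
  the overlaps glue to a UNIQUE `G : Z → X`; `G` is again an `S`-morphism, and it extends `f₀ : Z₀ → X` as soon as the
  `g α` extend `f₀` on a cover of `Z₀` compatible with `𝒰` (`glue_over`, `glue_comp_eq`) — the sheaf condition of
  `𝒫(g₀)`, existence half; the overlap hypothesis is discharged chartwise by §1.

What is NOT here (next slices of the census row E3.1): the ACTION of a compatible family of chart derivations on a global
lift ((iv) existence: needs the localisation of derivations along `Γ(X, V) → Γ(X, V_s)` to compare charts of two local
lifts in a common smaller affine open) and the Čech-coboundary correction of local lifts ((iii)).

Cell hodgecm-mathlib (D-0151), SOCKETS-F §4 (α) node E3 brick DEF-MOR (iv)-sheaf layer (A-p01 (g8) census `E-census-E3E5`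
§1.3 row E3.1; hand released to this seat 18:49:29Z); count-neutral generic capital.  HC_CM is proved only modulo the 7
printed citations until rung 0 closes; this file discharges none of them.

## References
* [SGA1] A. Grothendieck, M. Raynaud, *Revêtements étales et groupe fondamental (SGA 1)*, LNM 224 / arXiv:math/0206203:
  Exp. III §5 (the sheaf `𝒫(g₀)` of local extensions; «l'ensemble des prolongements globaux est un espace principal
  homogène sous `H⁰(Y, 𝒢)`»), Prop. 5.1 (arXiv ed. pp. 70–71, held `paper:arxiv-math_0206203` p0049–p0050).
* [MumfordFogartyKirwan1994] *Geometric Invariant Theory*, 3rd ed., Ch. 6 §3 Prop. 6.15 (pp. 130–131): the consumer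
  («the set of all extensions is a principal homogeneous space under `H⁰(X̄ × X̄, μ̄^*𝒯 ⊗ I)`»).
-/

universe u

open CategoryTheory CategoryTheory.Limits AlgebraicGeometry

noncomputable section

namespace Literature.AlgebraicGeometry.Deformation

/-! ### §1 Chartwise criteria for equality of morphisms into `X` -/

section Charts

variable {X : Scheme.{u}} {V : X.Opens}

/-- **Two morphisms `Spec B → X` through an affine open `V` with equal charts are equal** (each is `Spec` of its chart
followed by `V ↪ X`, ★ `eq_specMap_appLE_comp_fromSpec`). [cite: SGA1, Exp. III §5 Prop. 5.1] -/
theorem eq_of_charts_eq (hV : IsAffineOpen V) {B : Type u} [CommRing B] {g g' : Spec (.of B) ⟶ X}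
    (hg : g ⁻¹ᵁ V = ⊤) (hg' : g' ⁻¹ᵁ V = ⊤)
    (h : g.appLE V ⊤ hg.ge ≫ (Scheme.ΓSpecIso (.of B)).hom = g'.appLE V ⊤ hg'.ge ≫ (Scheme.ΓSpecIso (.of B)).hom) :
    g = g' := by
  rw [eq_specMap_appLE_comp_fromSpec hV g hg, eq_specMap_appLE_comp_fromSpec hV g' hg', h]

/-- **Sheaf condition for morphisms into `X`, uniqueness half, in chart form**: two morphisms `a b : P → X` are equal as
soon as every point of `P` lies in the image of an affine test chart `t : Spec C → P` (an open immersion) such that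
`t ≫ a` and `t ≫ b` land in a common affine open `V` of `X` and have the same chart there.  (Mathlib
`Scheme.Cover.hom_ext` on the cover assembled from the charts, then `eq_of_charts_eq`.) [cite: SGA1, Exp. III §5 Prop. 5.1] -/
theorem eq_of_forall_exists_chart_eq {P : Scheme.{u}} {a b : P ⟶ X}
    (h : ∀ x : P, ∃ (C : Type u) (_ : CommRing C) (t : Spec (.of C) ⟶ P) (_ : IsOpenImmersion t)
      (_ : x ∈ Set.range t.base) (V : X.Opens) (_ : IsAffineOpen V) (ha : (t ≫ a) ⁻¹ᵁ V = ⊤)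
      (hb : (t ≫ b) ⁻¹ᵁ V = ⊤),
      (t ≫ a).appLE V ⊤ ha.ge ≫ (Scheme.ΓSpecIso (.of C)).hom =
        (t ≫ b).appLE V ⊤ hb.ge ≫ (Scheme.ΓSpecIso (.of C)).hom) :
    a = b := by
  choose C _inst t ht hx V hV ha hb hchart using h
  let 𝒰 : P.OpenCover := Scheme.Cover.mkOfCovers (P := @IsOpenImmersion) (↥P) (fun x => Spec (.of (C x))) t
    (fun x => by obtain ⟨y, hy⟩ := hx x; exact ⟨x, y, hy⟩) (fun x => ht x)
  exact Scheme.Cover.hom_ext 𝒰 a b fun x => eq_of_charts_eq (hV x) (ha x) (hb x) (hchart x)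

variable {R₀ B B₀ : Type u} [CommRing R₀] [CommRing B] [CommRing B₀] [Algebra R₀ B]
  (p : X ⟶ Spec (.of R₀)) (π : B →+* B₀)

/-- **Two `S`-lifts through an affine open `V` agreeing on the square-zero `Spec B₀` are equal iff their charts are
equal, i.e. iff the derivation of ★ `existsUnique_derivation_of_lifts` vanishes** — the torsor is simply transitive:
«`ψ₂ = ψ₁ + δ` with `δ = 0`».  Stated def-free: if some function `δ` with `ψ₂ = ψ₁ + δ` vanishes identically then
`g₁ = g₂`. [cite: SGA1, Exp. III §5 Prop. 5.1] -/
theorem eq_of_derivation_eq_zero (hV : IsAffineOpen V) {g₁ g₂ : Spec (.of B) ⟶ X} (hg₁ : g₁ ⁻¹ᵁ V = ⊤)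
    (hg₂ : g₂ ⁻¹ᵁ V = ⊤) {δ : Γ(X, V) → B}
    (hδ : ∀ a, (g₂.appLE V ⊤ hg₂.ge ≫ (Scheme.ΓSpecIso (.of B)).hom).hom a =
      (g₁.appLE V ⊤ hg₁.ge ≫ (Scheme.ΓSpecIso (.of B)).hom).hom a + δ a)
    (h0 : ∀ a, δ a = 0) : g₁ = g₂ := by
  refine eq_of_charts_eq hV hg₁ hg₂ ?_
  ext a
  rw [hδ a, h0 a, add_zero]

/-- Conversely equal lifts have vanishing difference: if `g₁ = g₂` then any `δ` with `ψ₂ = ψ₁ + δ` is zero.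
[cite: SGA1, Exp. III §5 Prop. 5.1] -/
theorem derivation_eq_zero_of_eq {g₁ g₂ : Spec (.of B) ⟶ X} (hg₁ : g₁ ⁻¹ᵁ V = ⊤) (hg₂ : g₂ ⁻¹ᵁ V = ⊤)
    {δ : Γ(X, V) → B}
    (hδ : ∀ a, (g₂.appLE V ⊤ hg₂.ge ≫ (Scheme.ΓSpecIso (.of B)).hom).hom a =
      (g₁.appLE V ⊤ hg₁.ge ≫ (Scheme.ΓSpecIso (.of B)).hom).hom a + δ a)
    (h : g₁ = g₂) (a : Γ(X, V)) : δ a = 0 := by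
  subst h
  have := hδ a
  rwa [left_eq_add] at this

end Charts

/-! ### §2 Gluing local lifts (the sheaf condition of `𝒫(g₀)`, existence half) -/

section Glue

variable {Z X : Scheme.{u}} (𝒰 : Z.OpenCover) (g : ∀ α, 𝒰.X α ⟶ X)

/-- **Local lifts which agree on the overlaps glue to a unique global morphism** (Mathlib `Scheme.Cover.glueMorphisms`;
uniqueness `Scheme.Cover.hom_ext`): «les sections sur un ouvert `U` sont les prolongements `g : U → X`» form a sheaf.
[cite: SGA1, Exp. III §5 Prop. 5.1] -/
theorem existsUnique_glue_of_lifts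
    (hg : ∀ α β, pullback.fst (𝒰.f α) (𝒰.f β) ≫ g α = pullback.snd (𝒰.f α) (𝒰.f β) ≫ g β) :
    ∃! G : Z ⟶ X, ∀ α, 𝒰.f α ≫ G = g α :=
  ⟨Scheme.Cover.glueMorphisms 𝒰 g hg, Scheme.Cover.ι_glueMorphisms 𝒰 g hg, fun _ hG =>
    Scheme.Cover.hom_ext 𝒰 _ _ fun α => by rw [hG α, Scheme.Cover.ι_glueMorphisms]⟩

variable {R₀ : Type u} [CommRing R₀] (p : X ⟶ Spec (.of R₀)) (q : Z ⟶ Spec (.of R₀))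

/-- **The glued morphism is an `S`-morphism** when the local lifts are (`g α ≫ p = 𝒰.f α ≫ q`): a morphism to `S` is
determined on an open cover. [cite: SGA1, Exp. III §5 Prop. 5.1] -/
theorem glue_over {G : Z ⟶ X} (hG : ∀ α, 𝒰.f α ≫ G = g α) (w : ∀ α, g α ≫ p = 𝒰.f α ≫ q) : G ≫ p = q :=
  Scheme.Cover.hom_ext 𝒰 _ _ fun α => by rw [← Category.assoc, hG α, w α]

/-- **The glued morphism extends `f₀`** when the local lifts do: for a morphism `i : Z₀ → Z` (the thickening), an open
cover `𝒰₀` of `Z₀` mapping into `𝒰` by `k α : 𝒰₀.X α → 𝒰.X (c α)` over `i` (`k α ≫ 𝒰.f (c α) = 𝒰₀.f α ≫ i`), and local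
lifts extending `f₀` (`k α ≫ g (c α) = 𝒰₀.f α ≫ f₀`), the glued `G` satisfies `i ≫ G = f₀`. [cite: SGA1, Exp. III §5 Prop. 5.1] -/
theorem glue_comp_eq {Z₀ : Scheme.{u}} (i : Z₀ ⟶ Z) (f₀ : Z₀ ⟶ X) (𝒰₀ : Z₀.OpenCover) (c : 𝒰₀.I₀ → 𝒰.I₀)
    (k : ∀ α, 𝒰₀.X α ⟶ 𝒰.X (c α)) (hk : ∀ α, k α ≫ 𝒰.f (c α) = 𝒰₀.f α ≫ i)
    {G : Z ⟶ X} (hG : ∀ α, 𝒰.f α ≫ G = g α) (h₀ : ∀ α, k α ≫ g (c α) = 𝒰₀.f α ≫ f₀) : i ≫ G = f₀ :=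
  Scheme.Cover.hom_ext 𝒰₀ _ _ fun α => by rw [← Category.assoc, ← hk α, Category.assoc, hG (c α), h₀ α]

/-- **Global uniqueness of lifts from local data** (the `H⁰`-torsor is simply transitive): two morphisms `G₁ G₂ : Z → X`
which agree on every member of an open cover are equal; combined with `eq_of_derivation_eq_zero` chart by chart: two
global `S`-lifts of `f₀` all of whose chart derivations vanish coincide. [cite: SGA1, Exp. III §5 Prop. 5.1] -/
theorem eq_of_forall_map_comp_eq {G₁ G₂ : Z ⟶ X} (h : ∀ α, 𝒰.f α ≫ G₁ = 𝒰.f α ≫ G₂) : G₁ = G₂ :=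
  Scheme.Cover.hom_ext 𝒰 _ _ h

end Glue

end Literature.AlgebraicGeometry.Deformation

end
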